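import Summits.QuantumFields.BalabanUV.T4Continuum.Support.NE7K1LinHomGramSums
import Summits.QuantumFields.BalabanUV.T4Continuum.Support.NE7K1LinHomKernelBond

/-!
# NE7K1LinHomGramKernel — row NE7 (node U5), candidate route HOM, path H1L, cell K1-lin(s): THE GRAM MATRIX OF THE INTERPOLATION
# KERNEL `G(Y,Z) = Σ_t k̃(t,Y)k̃(t,Z)` in closed form, and its absolute row sum `≤ (37∕30)·L`

Lineage `b2b-balaban-t4-ne7-p2` (CRUX PROVER NE7 #2), generation 66 (ninth file; Gram sharpening).  With `p = [1 ≤ Y]`, `q = [Y+1 < N]`,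
`q′ = [Y+2 < N]` the folded kernel's Gram entries on a coarse segment `[0,N)` are (all [folklore]):

* `gramK_three` (reduction to the three blocks around column `Y`, equality form of the three-point support `sum_eq_three`);
  **`gramK_diag`** `G(Y,Y) = L + (p+q)A∕2 + pqB∕2`; **`gramK_offDiag_one`** `G(Y,Y+1) = −A∕2 − (p+q′)B∕4`;
  **`gramK_offDiag_two`** `G(Y,Y+2) = B∕4`; `gramK_far` (`0` three or more columns away), `gramK_out`, `gramK_comm`.
* **`gramK_row_abs`**: `Σ_Z |G(Y,Z)| ≤ L + 2A + B ≤ (37∕30)·L` at every coarse site (five-point support `sum_abs_le_five`; the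
  indicator bookkeeping `gram_row_core`: the row sum is EXACTLY `L + (p+q)A + pqB`; `NE7K1LinHomGramSums.gram_row_const_le`).
  The continuum value is `74∕60 = 1.2333…`; the discrete row sums increase to it (`1.0625, 1.148, 1.184, …` for `L = 2, 3, 4, …`).

HONEST FRAMING: Gaussian `A = 0`, finite boxes, finite real matrices, [folklore]; ONE RG step in `U = 1` gauge; a census ∕
NEEDS-CONSTANT sharpening of the L-uniform upper two-run constant of `NE7K1LinHomUpper` (`5·(5∕2)^d ↦ 3·(37∕30)^d` with `NE7K1LinHomGramBond`), no letter ∕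
tag ∕ size of NE7 moves; nothing printed asserted; no `sorry`.  FIXED FINITE T⁴, rung (B)+1; NE7 NOT PRINTED ∕ NOT PROVED; spine 0∕9;
NOT infinite volume, NOT mass gap, NOT Clay.  HONEST DEPENDENCY: continuum YM on T⁴ ⇐ BetaPertH ∧ nine spine estimates (0/9 proved);
BetaPertH ⇐ (D1) ∧ (D4) ∧ CAP+tail; G-an2-4 gates asym, D1 and NE2/3/4.
-/

noncomputable section

open Finset

namespace Summit.QuantumFields.BalabanUV.T4Continuum.NE7K1LinHomGramKernel

open NE7K1LinHomKernel NE7K1LinHomKernelSums NE7K1LinHomKernelBond NE7K1LinHomGramSums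

/-! ### §2 The Gram matrix of the interpolation kernel: `G(Y,Z) = Σ_t k̃(t,Y)k̃(t,Z)` -/

/-- the Gram entry of two columns of the folded kernel. [folklore] -/
def gramK (N L : ℕ) (Y Z : ℤ) : ℝ := ∑ t ∈ range (N * L), kerF N L t Y * kerF N L t Z

section Gram

variable {N L : ℕ}

/-- three-point support, EQUALITY form: a function on `ℤ` vanishing off `{a−1, a, a+1}` and outside the finite `S` sums over `S` to
`f(a−1) + f(a) + f(a+1)`. [folklore] -/
theorem sum_eq_three (S : Finset ℤ) (f : ℤ → ℝ) (a : ℤ) (hS : ∀ Y, Y ∉ S → f Y = 0)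
    (hf : ∀ Y, Y ≠ a - 1 → Y ≠ a → Y ≠ a + 1 → f Y = 0) :
    ∑ Y ∈ S, f Y = f (a - 1) + f a + f (a + 1) := by
  classical
  set T : Finset ℤ := {a - 1, a, a + 1} with hT
  have hzero : ∀ Y, Y ∉ T → f Y = 0 := by
    intro Y hY
    simp only [hT, Finset.mem_insert, Finset.mem_singleton, not_or] at hY
    exact hf Y hY.1 hY.2.1 hY.2.2
  calc ∑ Y ∈ S, f Y = ∑ Y ∈ S ∪ T, f Y := Finset.sum_subset Finset.subset_union_left fun Y _ hY => hS Y hY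
    _ = ∑ Y ∈ T, f Y := (Finset.sum_subset Finset.subset_union_right fun Y _ hY => hzero Y hY).symm
    _ = f (a - 1) + f a + f (a + 1) := by
        rw [hT, Finset.sum_insert (by simp only [Finset.mem_insert, Finset.mem_singleton]; omega),
          Finset.sum_insert (by simp only [Finset.mem_singleton]; omega), Finset.sum_singleton, add_assoc]

/-- the kernel vanishes at coarse labels outside the segment. [folklore] -/
theorem kerF_col_out (t : ℤ) {Y : ℤ} (hY : ¬ (0 ≤ Y ∧ Y < N)) : kerF N L t Y = 0 := by
  unfold kerF
  split_ifs with ht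
  · have hN : (1 : ℤ) ≤ N := by
      by_contra h
      have : (N : ℤ) * L ≤ 0 := by nlinarith
      omega
    rcases lt_or_ge Y 0 with h | h
    · rw [cumF_of_neg _ h, cumF_of_neg _ (by omega), sub_self]
    · rw [cumF_of_last_le _ (by omega) (by omega), cumF_of_last_le _ (by omega) (by omega), sub_self]
  · rfl

/-- the Gram entry as a block double sum. [folklore] -/
theorem gramK_blocks (Y Z : ℤ) :
    gramK N L Y Z = ∑ X ∈ (range N).image (Nat.cast : ℕ → ℤ), ∑ j ∈ range L, kerF N L (L * X + j) Y * kerF N L (L * X + j) Z := by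
  unfold gramK
  rw [sum_range_mul (fun t => kerF N L t Y * kerF N L t Z) N L]
  push_cast
  rw [sum_range_cast (fun X => ∑ j ∈ range L, kerF N L (L * X + j) Y * kerF N L (L * X + j) Z) N]

/-- a block of the Gram sum vanishes when the block is outside the segment or not a neighbour of column `Y`. [folklore] -/
theorem gramK_block_zero {Y Z X : ℤ} (h : ¬ (0 ≤ X ∧ X < N) ∨ (X ≠ Y - 1 ∧ X ≠ Y ∧ X ≠ Y + 1)) :
    ∑ j ∈ range L, kerF N L (L * X + j) Y * kerF N L (L * X + j) Z = 0 := by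
  refine Finset.sum_eq_zero fun j hj => ?_
  have hjL := Finset.mem_range.1 hj
  rcases h with hX | ⟨h1, h2, h3⟩
  · rw [kerF_of_not_mem (not_mem_fine hX hjL) Y, zero_mul]
  · by_cases hX : 0 ≤ X ∧ X < N
    · rw [kerF_far hX.1 hX.2 (by positivity) (by exact_mod_cast hjL) (by omega) (by omega) (by omega), zero_mul]
    · rw [kerF_of_not_mem (not_mem_fine hX hjL) Y, zero_mul]

/-- the Gram entry reduced to the three blocks around column `Y`. [folklore] -/
theorem gramK_three (Y Z : ℤ) :
    gramK N L Y Z = ∑ j ∈ range L, kerF N L (L * (Y - 1) + j) Y * kerF N L (L * (Y - 1) + j) Z +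
      ∑ j ∈ range L, kerF N L (L * Y + j) Y * kerF N L (L * Y + j) Z +
      ∑ j ∈ range L, kerF N L (L * (Y + 1) + j) Y * kerF N L (L * (Y + 1) + j) Z := by
  rw [gramK_blocks]
  refine sum_eq_three _ _ Y (fun X hX => gramK_block_zero (Or.inl ?_)) (fun X h1 h2 h3 => gramK_block_zero (Or.inr ⟨h1, h2, h3⟩))
  intro h
  apply hX
  rw [Finset.mem_image]
  exact ⟨X.toNat, Finset.mem_range.2 (by omega), by omega⟩

/-- **THE DIAGONAL GRAM ENTRY**: `G(Y,Y) = L + ([1≤Y] + [Y+1<N])·A∕2 + [1≤Y][Y+1<N]·B∕2`. [folklore] -/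
theorem gramK_diag {Y : ℤ} (hY0 : 0 ≤ Y) (hYN : Y < N) :
    gramK N L Y Y = L +
      ((if 1 ≤ Y then (1 : ℝ) else 0) + (if Y + 1 < N then (1 : ℝ) else 0)) * (∑ j ∈ range L, shapeL L (j : ℤ) ^ 2) / 2 +
      (if 1 ≤ Y then (1 : ℝ) else 0) * (if Y + 1 < N then (1 : ℝ) else 0) *
        (∑ j ∈ range L, shapeL L (j : ℤ) * shapeR L (j : ℤ)) / 2 := by
  rw [gramK_three]
  set p : ℝ := if 1 ≤ Y then (1 : ℝ) else 0 with hp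
  set q : ℝ := if Y + 1 < N then (1 : ℝ) else 0 with hq
  have hp2 : p * p = p := by rcases ite_zero_or_one (1 ≤ Y) with h | h <;> rw [hp, h] <;> norm_num
  have hq2 : q * q = q := by rcases ite_zero_or_one (Y + 1 < (N : ℤ)) with h | h <;> rw [hq, h] <;> norm_num
  -- block Y − 1: `(r_j/2)²` if `1 ≤ Y`
  have h1 : ∑ j ∈ range L, kerF N L (L * (Y - 1) + j) Y * kerF N L (L * (Y - 1) + j) Y =
      p * (∑ j ∈ range L, shapeL L (j : ℤ) ^ 2) / 4 := by
    by_cases hY1 : 1 ≤ Y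
    · rw [hp, if_pos hY1, one_mul, ← sum_shapeR_sq, Finset.sum_div]
      refine Finset.sum_congr rfl fun j hj => ?_
      have hjL := Finset.mem_range.1 hj
      have hv := kerF_succ_val (N := N) (L := L) (X := Y - 1) (j := (j : ℤ)) (by omega) (by omega) (by positivity)
        (by exact_mod_cast hjL)
      rw [show Y - 1 + 1 = Y by ring] at hv
      rw [hv, if_pos hYN]; ring
    · rw [hp, if_neg hY1, gramK_block_zero (Or.inl (by omega))]; ring
  -- block Y: `(1 − q r_j/2 − p ℓ_j/2)²`
  have h2 : ∑ j ∈ range L, kerF N L (L * Y + j) Y * kerF N L (L * Y + j) Y =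
      L + q * (∑ j ∈ range L, shapeL L (j : ℤ) ^ 2) / 4 + p * (∑ j ∈ range L, shapeL L (j : ℤ) ^ 2) / 4 +
        p * q * (∑ j ∈ range L, shapeL L (j : ℤ) * shapeR L (j : ℤ)) / 2 := by
    have h : ∀ j ∈ range L, kerF N L (L * Y + j) Y * kerF N L (L * Y + j) Y =
        1 + q * (shapeR L j ^ 2 / 4) + p * (shapeL L j ^ 2 / 4) + p * q * (shapeL L j * shapeR L j / 2)
          - q * shapeR L j - p * shapeL L j := by
      intro j hj
      have hjL := Finset.mem_range.1 hj
      rw [kerF_self_val hY0 hYN (by positivity) (by exact_mod_cast hjL), ← hp, ← hq]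
      have e : (1 - q * (shapeR L j / 2) - p * (shapeL L j / 2)) * (1 - q * (shapeR L j / 2) - p * (shapeL L j / 2)) =
          1 + q * q * (shapeR L j ^ 2 / 4) + p * p * (shapeL L j ^ 2 / 4) + p * q * (shapeL L j * shapeR L j / 2)
            - q * shapeR L j - p * shapeL L j := by ring
      rw [e, hp2, hq2]
    rw [Finset.sum_congr rfl h]
    simp only [Finset.sum_add_distrib, Finset.sum_sub_distrib, Finset.sum_const, Finset.card_range, nsmul_eq_mul, mul_one,
      ← Finset.mul_sum, ← Finset.sum_div, sum_shapeL, sum_shapeR, sum_shapeR_sq, mul_zero, sub_zero]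
    ring
  -- block Y + 1: `(ℓ_j/2)²` if `Y + 1 < N`
  have h3 : ∑ j ∈ range L, kerF N L (L * (Y + 1) + j) Y * kerF N L (L * (Y + 1) + j) Y =
      q * (∑ j ∈ range L, shapeL L (j : ℤ) ^ 2) / 4 := by
    by_cases hY1 : Y + 1 < N
    · rw [hq, if_pos hY1, one_mul, Finset.sum_div]
      refine Finset.sum_congr rfl fun j hj => ?_
      have hjL := Finset.mem_range.1 hj
      have hv := kerF_pred_val (N := N) (L := L) (X := Y + 1) (j := (j : ℤ)) (by omega) hY1 (by positivity)
        (by exact_mod_cast hjL)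
      rw [show Y + 1 - 1 = Y by ring] at hv
      rw [hv, if_pos (by omega)]; ring
    · rw [hq, if_neg hY1, gramK_block_zero (Or.inl (by omega))]; ring
  rw [h1, h2, h3]
  ring

/-- a block of the Gram sum vanishes when the block is not a neighbour of column `Z` (second factor). [folklore] -/
theorem gramK_block_zero_right {Y Z X : ℤ} (h : X ≠ Z - 1 ∧ X ≠ Z ∧ X ≠ Z + 1) :
    ∑ j ∈ range L, kerF N L (L * X + j) Y * kerF N L (L * X + j) Z = 0 := by
  refine Finset.sum_eq_zero fun j hj => ?_
  have hjL := Finset.mem_range.1 hj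
  by_cases hX : 0 ≤ X ∧ X < N
  · rw [kerF_far (Y := Z) hX.1 hX.2 (by positivity) (by exact_mod_cast hjL) (by omega) (by omega) (by omega), mul_zero]
  · rw [kerF_of_not_mem (not_mem_fine hX hjL) Z, mul_zero]

/-- **THE FIRST OFF-DIAGONAL GRAM ENTRY**: `G(Y,Y+1) = −A∕2 − ([1≤Y] + [Y+2<N])·B∕4` (`Y + 1 < N`). [folklore] -/
theorem gramK_offDiag_one {Y : ℤ} (hY0 : 0 ≤ Y) (hYN : Y + 1 < N) :
    gramK N L Y (Y + 1) = -(∑ j ∈ range L, shapeL L (j : ℤ) ^ 2) / 2 -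
      ((if 1 ≤ Y then (1 : ℝ) else 0) + (if Y + 2 < N then (1 : ℝ) else 0)) *
        (∑ j ∈ range L, shapeL L (j : ℤ) * shapeR L (j : ℤ)) / 4 := by
  rw [gramK_three]
  set p : ℝ := if 1 ≤ Y then (1 : ℝ) else 0 with hp
  set q' : ℝ := if Y + 2 < N then (1 : ℝ) else 0 with hq'
  have h1 : ∑ j ∈ range L, kerF N L (L * (Y - 1) + j) Y * kerF N L (L * (Y - 1) + j) (Y + 1) = 0 :=
    gramK_block_zero_right ⟨by omega, by omega, by omega⟩
  have h2 : ∑ j ∈ range L, kerF N L (L * Y + j) Y * kerF N L (L * Y + j) (Y + 1) =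
      -(∑ j ∈ range L, shapeL L (j : ℤ) ^ 2) / 4 - p * (∑ j ∈ range L, shapeL L (j : ℤ) * shapeR L (j : ℤ)) / 4 := by
    have h : ∀ j ∈ range L, kerF N L (L * Y + j) Y * kerF N L (L * Y + j) (Y + 1) =
        shapeR L j / 2 - shapeR L j ^ 2 / 4 - p * (shapeL L j * shapeR L j / 4) := by
      intro j hj
      have hjL := Finset.mem_range.1 hj
      rw [kerF_self_val hY0 (by omega) (by positivity) (by exact_mod_cast hjL), ← hp, if_pos hYN,
        kerF_succ_val hY0 (by omega) (by positivity) (by exact_mod_cast hjL), if_pos hYN]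
      ring
    rw [Finset.sum_congr rfl h]
    simp only [Finset.sum_sub_distrib, ← Finset.mul_sum, ← Finset.sum_div, sum_shapeR, sum_shapeR_sq, zero_div, zero_sub]
    ring
  have h3 : ∑ j ∈ range L, kerF N L (L * (Y + 1) + j) Y * kerF N L (L * (Y + 1) + j) (Y + 1) =
      -(q' * (∑ j ∈ range L, shapeL L (j : ℤ) * shapeR L (j : ℤ)) / 4) - (∑ j ∈ range L, shapeL L (j : ℤ) ^ 2) / 4 := by
    have h : ∀ j ∈ range L, kerF N L (L * (Y + 1) + j) Y * kerF N L (L * (Y + 1) + j) (Y + 1) =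
        shapeL L j / 2 - q' * (shapeL L j * shapeR L j / 4) - shapeL L j ^ 2 / 4 := by
      intro j hj
      have hjL := Finset.mem_range.1 hj
      have hv := kerF_pred_val (N := N) (L := L) (X := Y + 1) (j := (j : ℤ)) (by omega) hYN (by positivity)
        (by exact_mod_cast hjL)
      rw [show Y + 1 - 1 = Y by ring] at hv
      rw [hv, if_pos (by omega), kerF_self_val (X := Y + 1) (by omega) hYN (by positivity) (by exact_mod_cast hjL),
        ← show q' = (if Y + 1 + 1 < (N : ℤ) then (1 : ℝ) else 0) by rw [hq']; congr 1; simp only [eq_iff_iff]; omega,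
        if_pos (show (1 : ℤ) ≤ Y + 1 by omega)]
      ring
    rw [Finset.sum_congr rfl h]
    simp only [Finset.sum_sub_distrib, ← Finset.mul_sum, ← Finset.sum_div, sum_shapeL, zero_div, zero_sub]
    ring
  rw [h1, h2, h3]
  ring

/-- **THE SECOND OFF-DIAGONAL GRAM ENTRY**: `G(Y,Y+2) = B∕4` (`Y + 2 < N`). [folklore] -/
theorem gramK_offDiag_two {Y : ℤ} (hY0 : 0 ≤ Y) (hYN : Y + 2 < N) :
    gramK N L Y (Y + 2) = (∑ j ∈ range L, shapeL L (j : ℤ) * shapeR L (j : ℤ)) / 4 := by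
  rw [gramK_three, gramK_block_zero_right ⟨by omega, by omega, by omega⟩,
    gramK_block_zero_right (X := Y) (Z := Y + 2) ⟨by omega, by omega, by omega⟩, zero_add, zero_add, Finset.sum_div]
  refine Finset.sum_congr rfl fun j hj => ?_
  have hjL := Finset.mem_range.1 hj
  have hv := kerF_pred_val (N := N) (L := L) (X := Y + 1) (j := (j : ℤ)) (by omega) (by omega) (by positivity)
    (by exact_mod_cast hjL)
  rw [show Y + 1 - 1 = Y by ring] at hv
  have hw := kerF_succ_val (N := N) (L := L) (X := Y + 1) (j := (j : ℤ)) (by omega) (by omega) (by positivity)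
    (by exact_mod_cast hjL)
  rw [show Y + 1 + 1 = Y + 2 by ring] at hw
  rw [hv, hw, if_pos (by omega), if_pos hYN]
  ring

/-- the Gram entry vanishes three or more columns away. [folklore] -/
theorem gramK_far {Y Z : ℤ} (h : Z + 3 ≤ Y ∨ Y + 3 ≤ Z) : gramK N L Y Z = 0 := by
  rw [gramK_three, gramK_block_zero_right ⟨by omega, by omega, by omega⟩,
    gramK_block_zero_right (X := Y) ⟨by omega, by omega, by omega⟩,
    gramK_block_zero_right (X := Y + 1) ⟨by omega, by omega, by omega⟩, add_zero, add_zero]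

/-- the Gram entry vanishes at labels outside the segment. [folklore] -/
theorem gramK_out {Y Z : ℤ} (hZ : ¬ (0 ≤ Z ∧ Z < N)) : gramK N L Y Z = 0 := by
  unfold gramK
  exact Finset.sum_eq_zero fun t _ => by rw [kerF_col_out _ hZ, mul_zero]

/-- the Gram matrix is symmetric. [folklore] -/
theorem gramK_comm (Y Z : ℤ) : gramK N L Y Z = gramK N L Z Y := by
  unfold gramK
  exact Finset.sum_congr rfl fun t _ => mul_comm _ _

/-- five-point support bound: `Σ_S |f| ≤ |f(a−2)| + |f(a−1)| + |f a| + |f(a+1)| + |f(a+2)|`. [folklore] -/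
theorem sum_abs_le_five (S : Finset ℤ) (f : ℤ → ℝ) (a : ℤ)
    (hf : ∀ Y, Y ≠ a - 2 → Y ≠ a - 1 → Y ≠ a → Y ≠ a + 1 → Y ≠ a + 2 → f Y = 0) :
    ∑ Y ∈ S, |f Y| ≤ |f (a - 2)| + |f (a - 1)| + |f a| + |f (a + 1)| + |f (a + 2)| := by
  classical
  set T : Finset ℤ := {a - 2, a - 1, a, a + 1, a + 2} with hT
  have hzero : ∀ Y, Y ∉ T → f Y = 0 := by
    intro Y hY
    simp only [hT, Finset.mem_insert, Finset.mem_singleton, not_or] at hY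
    exact hf Y hY.1 hY.2.1 hY.2.2.1 hY.2.2.2.1 hY.2.2.2.2
  calc ∑ Y ∈ S, |f Y| ≤ ∑ Y ∈ S ∪ T, |f Y| :=
        Finset.sum_le_sum_of_subset_of_nonneg Finset.subset_union_left fun _ _ _ => abs_nonneg _
    _ = ∑ Y ∈ T, |f Y| :=
        (Finset.sum_subset Finset.subset_union_right fun Y _ hY => by rw [hzero Y hY, abs_zero]).symm
    _ = |f (a - 2)| + |f (a - 1)| + |f a| + |f (a + 1)| + |f (a + 2)| := by
        rw [hT, Finset.sum_insert (by simp only [Finset.mem_insert, Finset.mem_singleton]; omega),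
          Finset.sum_insert (by simp only [Finset.mem_insert, Finset.mem_singleton]; omega),
          Finset.sum_insert (by simp only [Finset.mem_insert, Finset.mem_singleton]; omega),
          Finset.sum_insert (by simp only [Finset.mem_singleton]; omega), Finset.sum_singleton]
        ring

/-- the core inequality of the Gram row bound. [folklore] -/
theorem gram_row_core {p q q' p'' A B l : ℝ} (hp : p = 0 ∨ p = 1) (hq : q = 0 ∨ q = 1) (hq' : q' = 0 ∨ q' = 1)
    (hp'' : p'' = 0 ∨ p'' = 1) (hqq : q' ≤ q) (hpp : p'' ≤ p) (hA : 0 ≤ A) (hAB : 0 ≤ A + B) :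
    p'' * (-B / 4) + p * (A / 2 + (p'' + q) * B / 4) + (l + (p + q) * A / 2 + p * q * B / 2) +
        q * (A / 2 + (p + q') * B / 4) + q' * (-B / 4) ≤ l + 2 * A + B := by
  rcases hp with rfl | rfl <;> rcases hq with rfl | rfl <;> rcases hq' with rfl | rfl <;> rcases hp'' with rfl | rfl
  all_goals linarith

/-- **THE GRAM ROW BOUND OF THE INTERPOLATION KERNEL**: `Σ_Z |G(Y,Z)| ≤ L + 2A + B ≤ (37∕30)·L` at every coarse site `Y`
(`N ≥ 1`, `L ≥ 1`) — the sharp replacement of the Schur-test product `ρ₀ρ₁L = (5∕2)L`. [folklore] -/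
theorem gramK_row_abs (hL : 1 ≤ L) {Y : ℤ} (hY0 : 0 ≤ Y) (hYN : Y < N) :
    ∑ Z ∈ range N, |gramK N L Y Z| ≤ 37 / 30 * (L : ℝ) := by
  set A : ℝ := ∑ j ∈ range L, shapeL L (j : ℤ) ^ 2 with hAdef
  set B : ℝ := ∑ j ∈ range L, shapeL L (j : ℤ) * shapeR L (j : ℤ) with hBdef
  have hA : 0 ≤ A := sumA_nonneg L
  have hB : B ≤ 0 := sumB_nonpos hL
  have hAB : 0 ≤ A + B := sumA_add_sumB_nonneg L
  rw [sum_range_cast (fun Z => |gramK N L Y Z|) N]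
  have hfar : ∀ Z : ℤ, Z ≠ Y - 2 → Z ≠ Y - 1 → Z ≠ Y → Z ≠ Y + 1 → Z ≠ Y + 2 → gramK N L Y Z = 0 :=
    fun Z h1 h2 h3 h4 h5 => gramK_far (by omega)
  refine (sum_abs_le_five _ _ Y hfar).trans ?_
  set p : ℝ := if 1 ≤ Y then (1 : ℝ) else 0 with hp
  set q : ℝ := if Y + 1 < N then (1 : ℝ) else 0 with hq
  set q' : ℝ := if Y + 2 < N then (1 : ℝ) else 0 with hq'
  set p'' : ℝ := if 2 ≤ Y then (1 : ℝ) else 0 with hp''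
  -- the five values
  have v0 : gramK N L Y Y = L + (p + q) * A / 2 + p * q * B / 2 := by
    rw [gramK_diag hY0 hYN, ← hp, ← hq]
  have v1 : |gramK N L Y (Y + 1)| = q * (A / 2 + (p + q') * B / 4) := by
    by_cases h : Y + 1 < N
    · rw [gramK_offDiag_one hY0 h, ← hp, ← hq', hq, if_pos h, one_mul]
      rw [show -A / 2 - (p + q') * B / 4 = -(A / 2 + (p + q') * B / 4) by ring, abs_neg, abs_of_nonneg]
      rcases ite_zero_or_one (1 ≤ Y) with h1 | h1 <;> rcases ite_zero_or_one (Y + 2 < (N : ℤ)) with h2 | h2 <;>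
        rw [hp, hq', h1, h2] <;> linarith
    · rw [gramK_out (by omega), hq, if_neg h]; simp
  have v2 : |gramK N L Y (Y + 2)| = q' * (-B / 4) := by
    by_cases h : Y + 2 < N
    · rw [gramK_offDiag_two hY0 h, hq', if_pos h, one_mul, abs_of_nonpos (by linarith)]; ring
    · rw [gramK_out (by omega), hq', if_neg h]; simp
  have vm1 : |gramK N L Y (Y - 1)| = p * (A / 2 + (p'' + q) * B / 4) := by
    by_cases h : 1 ≤ Y
    · have hg := gramK_offDiag_one (N := N) (L := L) (Y := Y - 1) (by omega) (by omega)
      rw [show Y - 1 + 1 = Y by ring, show Y - 1 + 2 = Y + 1 by ring] at hg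
      rw [gramK_comm, hg, hp, if_pos h, one_mul,
        show (if (1 : ℤ) ≤ Y - 1 then (1 : ℝ) else 0) = p'' by rw [hp'']; congr 1; simp only [eq_iff_iff]; omega, ← hq]
      rw [show -A / 2 - (p'' + q) * B / 4 = -(A / 2 + (p'' + q) * B / 4) by ring, abs_neg, abs_of_nonneg]
      rcases ite_zero_or_one (2 ≤ Y) with h1 | h1 <;> rcases ite_zero_or_one (Y + 1 < (N : ℤ)) with h2 | h2 <;>
        rw [hp'', hq, h1, h2] <;> linarith
    · rw [gramK_out (by omega), hp, if_neg h]; simp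
  have vm2 : |gramK N L Y (Y - 2)| = p'' * (-B / 4) := by
    by_cases h : 2 ≤ Y
    · have hg := gramK_offDiag_two (N := N) (L := L) (Y := Y - 2) (by omega) (by omega)
      rw [show Y - 2 + 2 = Y by ring] at hg
      rw [gramK_comm, hg, hp'', if_pos h, one_mul, abs_of_nonpos (by linarith)]; ring
    · rw [gramK_out (by omega), hp'', if_neg h]; simp
  have hl : (0 : ℝ) ≤ gramK N L Y Y := by
    rw [v0]
    have : B ≥ -(2 : ℝ) * L := by
      rw [hBdef, sum_shapeL_mul_shapeR hL]
      have hL1 : (1 : ℝ) ≤ L := by exact_mod_cast hL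
      rw [ge_iff_le, neg_mul, neg_le, neg_div, neg_neg, div_le_iff₀ (by positivity)]
      nlinarith [sq_nonneg ((L : ℝ) ^ 2)]
    rcases ite_zero_or_one (1 ≤ Y) with h1 | h1 <;> rcases ite_zero_or_one (Y + 1 < (N : ℤ)) with h2 | h2 <;>
      rw [hp, hq, h1, h2] <;> nlinarith
  rw [abs_of_nonneg hl, v0, v1, v2, vm1, vm2]
  have hqq : q' ≤ q := by
    rw [hq, hq']
    by_cases h1 : Y + 2 < (N : ℤ) <;> by_cases h2 : Y + 1 < (N : ℤ) <;> simp only [h1, h2, if_true, if_false] <;>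
      first | (exfalso; omega) | norm_num
  have hpp : p'' ≤ p := by
    rw [hp, hp'']
    by_cases h1 : (2 : ℤ) ≤ Y <;> by_cases h2 : (1 : ℤ) ≤ Y <;> simp only [h1, h2, if_true, if_false] <;>
      first | (exfalso; omega) | norm_num
  have core := gram_row_core (l := (L : ℝ)) (ite_zero_or_one (1 ≤ Y)) (ite_zero_or_one (Y + 1 < (N : ℤ)))
    (ite_zero_or_one (Y + 2 < (N : ℤ))) (ite_zero_or_one (2 ≤ Y)) (by rw [← hq, ← hq']; exact hqq)
    (by rw [← hp, ← hp'']; exact hpp) hA hAB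
  rw [← hp, ← hq, ← hq', ← hp''] at core
  exact core.trans (gram_row_const_le hL)

end Gram

end Summit.QuantumFields.BalabanUV.T4Continuum.NE7K1LinHomGramKernel
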